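import Mathlib
import Literature.AlgebraicGeometry.Resolution.ShearedMonomialNoAntiderivative
import Literature.RingTheory.MvPowerSeries.HasseDerivFrobeniusPow

/-!
# `WeightedInvariant.LocalWeightedDrop`, line `hasse-ridge-face-selection`, S3ρ sub-stub S3ρD₂ `stub_wildMonicSurfaceDescent₂`:
# CASE D-d (KANGAROO), part 2 — the ONE-VARIABLE ENDGAME of Perlega's modified Moh bound (Lemma 6.2.1 (3)(5)(6), Lemma 6.2.2)

Crux item stmt-ResolutionOfSingularities-8899 `LocalWeightedDrop` (route `ResolutionOfSingularities/WeightedInvariant`), engine of the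
door `HypersurfaceCentreConstruction` stmt-ResolutionOfSingularities-19897.  [OURS · L1 W4.3, chain w43, seat res-type-056 on ROADMAP item
(C8) = D-d KANGAROO of `L/res-L1-w43-stub-7/S3RHOD-ROADMAP.md`.  MODEL: S. Perlega, thesis Wien 2017 / arXiv:2011.14443, Ch. 6 §2.1
[cite: Perlega2020, Lemma 6.2.1 (3) «`ord_{(y)} f ≤ ord_{(y)} ∂_{y^k}(f) + k`», (5) «if `∂_{y^k}(f) ≠ 0` then `ord_{(y₁)} ∂_{y^k}(f) ≤ d(f)`;
if equality holds then `∂_{y^k}(f) = x^r y^s (y + t xⁿ)^{d(f)}`», (6) «`q ∣ w(f)`, `f ∉ K[[x^q,y^q]]`, `e₁` maximal with `f ∈ K[[x^r,y^r]]`,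
`r = p^{e₁}` ⇒ `∂_{y^r}(f) ≠ 0`», Lemma 6.2.2 «there is no `F` with `∂_y(F) = x^{r_x} y^{r_y} (y + t xⁿ)^{mp−1}`» (res-lit-5's
`Perlega2020.not_exists_coeff_antiderivative`, p489973, is the two-variable series form of that lemma)] = Hauser–Perlega, Publ. RIMS 60
(2024) Lemma 2, proof pp. 789–790.  Nothing here is a statement of H. Hironaka's manuscript [claim: Hironaka2017, status: under-review];
these are OUR lemmas on one-variable polynomials `P ∈ k[Y]`.]

WHY ONE VARIABLE.  A `w`-homogeneous two-variable form `G` of weight `W` (`w(x) = 1`, `w(y) = n`) is `x^W · P(y/xⁿ)` for its FLATTENING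
`P(Y) = Σ_j [x^{W−nj} y^j]G · Y^j` (the sibling `…WildMonicKangarooDefs.flatPoly`; Hauser–Perlega's `P♭`): `ord_{(y)} G = tdeg P`, Perlega's
`d(G) = ord G − ord_{(x)} G − ord_{(y)} G = deg P − tdeg P`, the Hasse derivative `∂_{y^k} G` flattens to `Polynomial.hasseDeriv k P`, the change to
the subordinate coordinates `(x, y₁ = y + t xⁿ)` flattens to the Taylor shift `P(Y − t)`, so `ord_{(y₁)} G = tdeg P(Y − t)`, and
`G ∈ k[[x^r, y^r]]` reads «every exponent of `P` is divisible by `r`» (given `r ∣ W`).  In that dictionary: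

* `natTrailingDegree_taylor_add_le` — `tdeg P(Y + c) + tdeg P ≤ deg P` (`c ≠ 0`): with `hasseDeriv_shift_sub_le` (`deg ∂_k P − tdeg ∂_k P ≤
  deg P − tdeg P`) this is Lemma 6.2.1 (5) «`ord_{(y₁)} ∂_{y^k} G ≤ d(G)`»; `eq_C_mul_X_pow_mul_pow_of_natTrailingDegree_taylor` is its
  equality case «`∂_{y^k} G = x^r y^s (y + t xⁿ)^{d}`»: `P = a · Y^{tdeg P} · (Y − c)^{deg P − tdeg P}`.
* `hasseDeriv_taylor_comm` — `∂_k` commutes with Taylor shifts (Lemma 6.2.1 (4) «`∂_{y₁^k} = ∂_{y^k}`» in the dictionary);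
  `le_natTrailingDegree_hasseDeriv_add` — Lemma 6.2.1 (3) «`ord_{(y)} f ≤ ord_{(y)} ∂_{y^k} f + k`» for polynomials.
* `exists_hasseDeriv_prime_pow_ne_zero` — Lemma 6.2.1 (6): if some exponent of `P ≠ 0` is not divisible by `q = p^a` then for some
  `e < a` every exponent is divisible by `p^e` and `∂_{p^e} P ≠ 0` (Lucas: `C(p^e u, p^e) ≡ u (mod p)`, the tree's `choose_pow_mul_modEq`).
* `hasseDeriv_ne_C_mul_X_pow_mul_pow` — THE DIGIT COUNT OF LEMMA 6.2.2 in the shape the equality case of Prop. 6.2.3 (4) needs: in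
  characteristic `p`, if every exponent of `P` is divisible by `r = p^e`, then `∂_r P ≠ a · Y^s · (Y + c)^{r (p^b − 1)}` for `a, c ≠ 0`, `b ≥ 1`
  (the right side is `a Y^s (Y^r + c^r)^{p^b − 1}`, all of whose `p^b ≥ p` coefficients `C(p^b − 1, i)` are units (Lucas, via res-lit-5's
  `Perlega2020.not_dvd_choose_prime_sub_one`), while `[Y^{s + r i}] ∂_r P = C(s + r(i+1), r)·P_{s+r(i+1)} ≡ (s/r + i + 1)·P_{…}` vanishes for the
  `i < p` with `p ∣ s/r + i + 1` — Perlega: «a term `x^i y^{kp−1}` appears … since `∂_y(x^i y^{kp}) = 0`, there can be no element `F` …»).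
AI-written; gate-accepted means sorry-free with standard axioms, not refereed.
-/

set_option linter.dupNamespace false -- mandated namespace of this single-conjunct summit

namespace Summit.ResolutionOfSingularities.ResolutionOfSingularities.Theorems

namespace WildMonic

open Polynomial

variable {k : Type*} [Field k]

/-! ## Taylor shifts and Hasse derivatives commute; orders under `∂_k` -/

/-- Lemma 6.2.1 (4) in the flattened dictionary: Hasse derivatives commute with Taylor shifts, `∂_k (P(Y + c)) = (∂_k P)(Y + c)`. -/
theorem hasseDeriv_taylor_comm (k' : ℕ) (c : k) (f : k[X]) :
    hasseDeriv k' (taylor c f) = taylor c (hasseDeriv k' f) := by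
  ext i
  rw [hasseDeriv_coeff, taylor_coeff, taylor_coeff]
  have h := congrArg (fun L : k[X] →ₗ[k] k[X] => (L f).eval c) (hasseDeriv_comp (R := k) i k')
  simp only [LinearMap.comp_apply, LinearMap.smul_apply] at h
  rw [h, eval_smul, nsmul_eq_mul, Nat.choose_symm_add]

/-- Lemma 6.2.1 (3) for polynomials: `tdeg P ≤ tdeg (∂_k P) + k` (when `∂_k P ≠ 0`): a Hasse derivative of order `k` lowers the `Y`-adic
order by at most `k`. -/
theorem le_natTrailingDegree_hasseDeriv_add (k' : ℕ) {f : k[X]} (h : hasseDeriv k' f ≠ 0) :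
    f.natTrailingDegree ≤ (hasseDeriv k' f).natTrailingDegree + k' := by
  have key : f.natTrailingDegree - k' ≤ (hasseDeriv k' f).natTrailingDegree := by
    refine le_natTrailingDegree h fun m hm => ?_
    rw [hasseDeriv_coeff, coeff_eq_zero_of_lt_natTrailingDegree (by omega), mul_zero]
  omega

/-- `deg ∂_k P − tdeg ∂_k P ≤ deg P − tdeg P`, in subtraction-free form (for `∂_k P ≠ 0`). -/
theorem hasseDeriv_shift_sub_le (k' : ℕ) {f : k[X]} (h : hasseDeriv k' f ≠ 0) :
    (hasseDeriv k' f).natDegree + f.natTrailingDegree ≤ f.natDegree + (hasseDeriv k' f).natTrailingDegree := by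
  have h1 := natDegree_hasseDeriv_le f k'
  have h2 := le_natTrailingDegree_hasseDeriv_add k' h
  have h3 : k' ≤ f.natDegree := by
    by_contra hlt
    exact h (hasseDeriv_eq_zero_of_lt_natDegree f k' (not_le.mp hlt))
  omega

/-! ## Trailing degrees of Taylor shifts (Lemma 6.2.1 (5) flattened) -/

/-- A polynomial whose trailing degree equals its degree is a monomial. -/
theorem eq_C_mul_X_pow_of_natTrailingDegree_eq_natDegree {f : k[X]} (h : f.natTrailingDegree = f.natDegree) :
    f = C f.leadingCoeff * X ^ f.natDegree := by
  classical
  refine (C_mul_X_pow_eq_self ?_).symm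
  refine Finset.card_le_one.mpr fun a ha b hb => ?_
  rw [mem_support_iff] at ha hb
  have ha1 := natTrailingDegree_le_of_ne_zero ha
  have ha2 := le_natDegree_of_ne_zero ha
  have hb1 := natTrailingDegree_le_of_ne_zero hb
  have hb2 := le_natDegree_of_ne_zero hb
  omega

/-- The trailing degree of `(Y + c)^s` is `0` for `c ≠ 0`. -/
theorem natTrailingDegree_X_add_C_pow {c : k} (hc : c ≠ 0) (s : ℕ) : ((X + C c) ^ s).natTrailingDegree = 0 := by
  apply Nat.eq_zero_of_le_zero
  apply natTrailingDegree_le_of_ne_zero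
  rw [coeff_X_add_C_pow, Nat.sub_zero, Nat.choose_zero_right, Nat.cast_one, mul_one]
  exact pow_ne_zero _ hc

/-- The `X^{tdeg}`-free part: `f = X^{tdeg f} * g` with `g(0) ≠ 0` and `deg g + tdeg f = deg f`. -/
theorem exists_eq_X_pow_natTrailingDegree_mul {f : k[X]} (hf : f ≠ 0) :
    ∃ g : k[X], f = X ^ f.natTrailingDegree * g ∧ g.coeff 0 ≠ 0 ∧ g.natDegree + f.natTrailingDegree = f.natDegree := by
  have hdvd : X ^ f.natTrailingDegree ∣ f := X_pow_dvd_iff.mpr fun d hd => coeff_eq_zero_of_lt_natTrailingDegree hd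
  obtain ⟨g, hg⟩ := hdvd
  have hg0 : g ≠ 0 := by rintro rfl; exact hf (by rw [hg, mul_zero])
  refine ⟨g, hg, ?_, ?_⟩
  · have h := coeff_natTrailingDegree_ne_zero.mpr hf
    have h2 : (X ^ f.natTrailingDegree * g).coeff f.natTrailingDegree = g.coeff 0 := by
      rw [coeff_X_pow_mul', if_pos le_rfl, Nat.sub_self]
    rw [← hg] at h2
    rw [h2] at h
    exact h
  · have h := congrArg natDegree hg
    rw [natDegree_mul (pow_ne_zero _ X_ne_zero) hg0, natDegree_X_pow] at h
    omega

/-- LEMMA 6.2.1 (5), FLATTENED: `tdeg P(Y + c) + tdeg P ≤ deg P` for `c ≠ 0` — the factor `(Y + c)^{tdeg P}` is a unit at the origin, and the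
trailing degree of the shifted cofactor is at most its degree. -/
theorem natTrailingDegree_taylor_add_le {c : k} (hc : c ≠ 0) {f : k[X]} (hf : f ≠ 0) :
    (taylor c f).natTrailingDegree + f.natTrailingDegree ≤ f.natDegree := by
  obtain ⟨g, hg, hg0, hdeg⟩ := exists_eq_X_pow_natTrailingDegree_mul hf
  have hgne : g ≠ 0 := fun h => hg0 (by rw [h, coeff_zero])
  have htg : taylor c g ≠ 0 := fun h => hgne ((taylor_eq_zero c g).mp h)
  have hXc : ((X + C c) ^ f.natTrailingDegree : k[X]) ≠ 0 := pow_ne_zero _ (X_add_C_ne_zero c)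
  have h1 : (taylor c f).natTrailingDegree = (taylor c g).natTrailingDegree := by
    rw [hg, taylor_mul, taylor_pow, taylor_X, natTrailingDegree_mul hXc htg, natTrailingDegree_X_add_C_pow hc, zero_add]
  have h2 : (taylor c g).natTrailingDegree ≤ g.natDegree :=
    (natTrailingDegree_le_natDegree _).trans (natDegree_taylor g c).le
  omega

/-- THE EQUALITY CASE OF LEMMA 6.2.1 (5), FLATTENED: if `tdeg P(Y + c) + tdeg P = deg P` (`c ≠ 0`, `P ≠ 0`) then
`P = a · Y^{tdeg P} · (Y − c)^{deg P − tdeg P}` with `a = lead P` (Perlega: «`∂_{y^k}(f) = x^r y^s (y + t xⁿ)^{d(f)}`»). -/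
theorem eq_C_mul_X_pow_mul_pow_of_natTrailingDegree_taylor {c : k} (hc : c ≠ 0) {f : k[X]} (hf : f ≠ 0)
    (h : (taylor c f).natTrailingDegree + f.natTrailingDegree = f.natDegree) :
    f = C f.leadingCoeff * X ^ f.natTrailingDegree * (X - C c) ^ (f.natDegree - f.natTrailingDegree) := by
  obtain ⟨g, hg, hg0, hdeg⟩ := exists_eq_X_pow_natTrailingDegree_mul hf
  have hgne : g ≠ 0 := fun h => hg0 (by rw [h, coeff_zero])
  have htg : taylor c g ≠ 0 := fun h => hgne ((taylor_eq_zero c g).mp h)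
  have hXc : ((X + C c) ^ f.natTrailingDegree : k[X]) ≠ 0 := pow_ne_zero _ (X_add_C_ne_zero c)
  have h1 : (taylor c f).natTrailingDegree = (taylor c g).natTrailingDegree := by
    rw [hg, taylor_mul, taylor_pow, taylor_X, natTrailingDegree_mul hXc htg, natTrailingDegree_X_add_C_pow hc, zero_add]
  -- the shifted cofactor is a monomial
  have h3 : (taylor c g).natTrailingDegree = (taylor c g).natDegree := by
    apply le_antisymm (natTrailingDegree_le_natDegree _)
    rw [natDegree_taylor]; omega
  have h4 := eq_C_mul_X_pow_of_natTrailingDegree_eq_natDegree h3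
  rw [leadingCoeff_taylor, natDegree_taylor] at h4
  -- shift back
  have h5 : g = C g.leadingCoeff * (X - C c) ^ g.natDegree := by
    have h7 : taylor (-c) (taylor c g) = C g.leadingCoeff * (X - C c) ^ g.natDegree := by
      rw [h4, taylor_mul, taylor_C, taylor_pow, taylor_X, C_neg, ← sub_eq_add_neg]
    rw [← h7, taylor_taylor, neg_add_cancel, taylor_zero]
  have hlead : f.leadingCoeff = g.leadingCoeff := by
    rw [hg, leadingCoeff_mul, leadingCoeff_X_pow, one_mul]
  have hgd : g.natDegree = f.natDegree - f.natTrailingDegree := by omega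
  calc f = X ^ f.natTrailingDegree * g := hg
    _ = X ^ f.natTrailingDegree * (C g.leadingCoeff * (X - C c) ^ g.natDegree) := by rw [← h5]
    _ = C f.leadingCoeff * X ^ f.natTrailingDegree * (X - C c) ^ (f.natDegree - f.natTrailingDegree) := by
        rw [hlead, hgd]; ring

/-! ## Lemma 6.2.1 (6): a Hasse derivative of `p`-power order that does not vanish -/

section CharP

variable (p : ℕ) [hp : Fact p.Prime] [CharP k p]

/-- Lucas: `C(p^e · u, p^e) ≡ u (mod p)`, cast into `k`. -/
theorem natCast_choose_prime_pow_mul (e u : ℕ) : (((p ^ e * u).choose (p ^ e) : ℕ) : k) = (u : k) := by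
  have h := Literature.RingTheory.MvPowerSeries.choose_pow_mul_modEq hp.out e u 1
  rw [mul_one, Nat.choose_one_right] at h
  exact CharP.natCast_eq_natCast' k p h

/-- LEMMA 6.2.1 (6), FLATTENED: if `P ≠ 0` has an exponent not divisible by `q = p^a`, then for some `e < a` EVERY exponent of `P` is
divisible by `r = p^e` and `∂_r P ≠ 0` (take `e` = the least `p`-adic valuation of a non-zero exponent; at an exponent `j = p^e u`, `p ∤ u`,
`[Y^{j − r}] ∂_r P = C(j, r) P_j ≡ u · P_j ≠ 0`). -/
theorem exists_hasseDeriv_prime_pow_ne_zero {a : ℕ} {P : k[X]} (h : ∃ j ∈ P.support, ¬ p ^ a ∣ j) :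
    ∃ e < a, (∀ j ∈ P.support, p ^ e ∣ j) ∧ hasseDeriv (p ^ e) P ≠ 0 := by
  classical
  -- the non-zero exponents and their valuations
  set S := P.support.filter (fun j => j ≠ 0) with hS
  have hSne : S.Nonempty := by
    obtain ⟨j, hj, hnd⟩ := h
    exact ⟨j, Finset.mem_filter.mpr ⟨hj, fun h0 => hnd (by rw [h0]; exact dvd_zero _)⟩⟩
  obtain ⟨j₀, hj₀S, hmin⟩ := S.exists_min_image (padicValNat p) hSne
  obtain ⟨hj₀, hj₀ne⟩ := Finset.mem_filter.mp hj₀S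
  set e := padicValNat p j₀ with he
  refine ⟨e, ?_, ?_, ?_⟩
  · -- `e < a`: the witness exponent has valuation `< a`, and `e` is the least valuation
    obtain ⟨j, hj, hnd⟩ := h
    have hjne : j ≠ 0 := fun h0 => hnd (by rw [h0]; exact dvd_zero _)
    have hle : e ≤ padicValNat p j := hmin j (Finset.mem_filter.mpr ⟨hj, hjne⟩)
    by_contra hae
    apply hnd
    rw [padicValNat_dvd_iff_le hjne]
    omega
  · intro j hj
    by_cases hjz : j = 0
    · rw [hjz]; exact dvd_zero _
    · rw [padicValNat_dvd_iff_le hjz]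
      exact hmin j (Finset.mem_filter.mpr ⟨hj, hjz⟩)
  · -- the coefficient at `j₀ − p^e`
    have hdvd : p ^ e ∣ j₀ := pow_padicValNat_dvd
    obtain ⟨u, hu⟩ := hdvd
    have hpu : ¬ p ∣ u := by
      intro hpu'
      obtain ⟨v, rfl⟩ := hpu'
      have : p ^ (e + 1) ∣ j₀ := ⟨v, by rw [hu]; ring⟩
      rw [padicValNat_dvd_iff_le hj₀ne] at this
      omega
    intro hzero
    have hc := congrArg (fun Q : k[X] => Q.coeff (j₀ - p ^ e)) hzero
    simp only [coeff_zero, hasseDeriv_coeff] at hc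
    have hle : p ^ e ≤ j₀ := Nat.le_of_dvd (Nat.pos_of_ne_zero hj₀ne) ⟨u, hu⟩
    rw [Nat.sub_add_cancel hle, hu, natCast_choose_prime_pow_mul p e u, mul_eq_zero] at hc
    rcases hc with hc | hc
    · exact hpu ((CharP.cast_eq_zero_iff k p u).mp hc)
    · rw [← hu] at hc
      exact (mem_support_iff.mp hj₀) hc

/-- If every exponent of `P ≠ 0` is divisible by `r`, then so is `deg P − tdeg P` (Perlega: «since `in_w(f_{c−q}) ∈ K[[x^r,y^r]]`,
`d(in_w(f_{c−q}))` is divisible by `r`»). -/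
theorem dvd_natDegree_sub_natTrailingDegree {r : ℕ} {P : k[X]} (hP0 : P ≠ 0) (hP : ∀ j ∈ P.support, r ∣ j) :
    r ∣ P.natDegree - P.natTrailingDegree :=
  Nat.dvd_sub (hP _ (natDegree_mem_support_of_nonzero hP0)) (hP _ (natTrailingDegree_mem_support_of_nonzero hP0))

/-! ## Lemma 6.2.2 in the shape the equality case of Prop. 6.2.3 (4) needs -/

/-- Lucas: `C(p^b − 1, i)` is a unit mod `p` for `i < p ≤ p^b` (the low digit of `p^b − 1` is `p − 1`). -/
theorem natCast_choose_prime_pow_sub_one_ne_zero {b : ℕ} (hb : 1 ≤ b) {i : ℕ} (hi : i < p) :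
    (((p ^ b - 1).choose i : ℕ) : k) ≠ 0 := by
  have hp' := hp.out
  rw [Ne, CharP.cast_eq_zero_iff k p]
  have luc := Choose.choose_modEq_choose_mod_mul_choose_div_nat (n := p ^ b - 1) (k := i) (p := p)
  have hmod : (p ^ b - 1) % p = p - 1 := by
    obtain ⟨b', rfl⟩ : ∃ b', b = b' + 1 := ⟨b - 1, by omega⟩
    have hP : 1 ≤ p ^ b' := Nat.one_le_pow b' p hp'.pos
    have hle : p ≤ p * p ^ b' := Nat.le_mul_of_pos_right p hP
    have h1 : p ^ (b' + 1) - 1 = (p - 1) + p * (p ^ b' - 1) := by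
      rw [pow_succ', Nat.mul_sub_one]
      omega
    rw [h1, Nat.add_mul_mod_self_left, Nat.mod_eq_of_lt (Nat.sub_lt hp'.pos one_pos)]
  rw [hmod, Nat.mod_eq_of_lt hi, Nat.div_eq_of_lt hi, Nat.choose_zero_right, mul_one] at luc
  intro hdvd
  exact Literature.AlgebraicGeometry.Resolution.Perlega2020.not_dvd_choose_prime_sub_one hp' hi ((luc.dvd_iff dvd_rfl).mp hdvd)

/-- Coefficients of `a · Y^s · (Y^r + c')^m`: at `Y^{s + r i}` (`i ≤ m`, `r ≥ 1`) the coefficient is `a · C(m, i) · c'^{m − i}`. -/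
theorem coeff_C_mul_X_pow_mul_X_pow_add_C_pow (a c' : k) (s m : ℕ) {r : ℕ} (hr : 1 ≤ r) {i : ℕ} (hi : i ≤ m) :
    (C a * X ^ s * (X ^ r + C c') ^ m).coeff (s + r * i) = a * ((m.choose i : ℕ) : k) * c' ^ (m - i) := by
  have hterm : ∀ j, ((X : k[X]) ^ r) ^ j * C c' ^ (m - j) * ((m.choose j : ℕ) : k[X]) =
      C (c' ^ (m - j) * (m.choose j : ℕ)) * X ^ (r * j) := by
    intro j
    rw [← pow_mul, ← C_pow, map_mul, map_natCast]
    ring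
  rw [mul_assoc, coeff_C_mul, coeff_X_pow_mul', if_pos (Nat.le_add_right _ _), Nat.add_sub_cancel_left, add_pow,
    finsetSum_coeff, Finset.sum_eq_single i]
  · rw [hterm, coeff_C_mul_X_pow, if_pos rfl]
    ring
  · intro j _ hji
    rw [hterm, coeff_C_mul_X_pow, if_neg]
    intro h
    exact hji (Nat.eq_of_mul_eq_mul_left hr h).symm
  · intro h
    exact absurd (Finset.mem_range.mpr (Nat.lt_succ_of_le hi)) h

/-- THE DIGIT COUNT OF LEMMA 6.2.2 (Perlega; Hauser–Perlega Lemma 2, third assertion): in characteristic `p`, if every exponent of `P` is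
divisible by `r = p^e`, then `∂_r P ≠ a · Y^s · (Y + c)^{r (p^b − 1)}` for `a ≠ 0`, `c ≠ 0`, `b ≥ 1`.  (With `F^r = G`, `∂_{y^r}(F^r) =
(∂_y F)^r`, this is «there is no `F` with `∂_y F = x^{r_x} y^{r_y} (y + t xⁿ)^{mp − 1}`», `m = p^{b−1}`, on the `r`-th power level and flattened.) -/
theorem hasseDeriv_ne_C_mul_X_pow_mul_pow {e b : ℕ} (hb : 1 ≤ b) {P : k[X]} (hP : ∀ j ∈ P.support, p ^ e ∣ j) {a c : k}
    (ha : a ≠ 0) (hc : c ≠ 0) (s : ℕ) :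
    hasseDeriv (p ^ e) P ≠ C a * X ^ s * (X + C c) ^ (p ^ e * (p ^ b - 1)) := by
  classical
  have hp' := hp.out
  set r := p ^ e with hr
  have hr1 : 1 ≤ r := Nat.one_le_pow e p hp'.pos
  set m := p ^ b - 1 with hm
  have hpm : p ≤ p ^ b := by
    calc p = p ^ 1 := (pow_one p).symm
      _ ≤ p ^ b := Nat.pow_le_pow_right hp'.pos hb
  intro hEq
  -- Frobenius: `(Y + c)^{r m} = (Y^r + c^r)^m`
  have hfrob : ((X + C c) ^ (r * m) : k[X]) = (X ^ r + C (c ^ r)) ^ m := by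
    rw [pow_mul, hr, add_pow_char_pow, ← C_pow]
  rw [hfrob] at hEq
  -- the coefficient of `∂_r P` at `Y^{s + r i}` is `C(s + r i + r, r) · P_{s + r i + r}`; on the right it is `a C(m,i) c^{r(m−i)} ≠ 0`
  have hcoeff : ∀ i, i ≤ m → (((s + r * i + r).choose r : ℕ) : k) * P.coeff (s + r * i + r) =
      a * ((m.choose i : ℕ) : k) * (c ^ r) ^ (m - i) := by
    intro i hi
    have h := congrArg (fun Q : k[X] => Q.coeff (s + r * i)) hEq
    simp only [hasseDeriv_coeff] at h
    rw [coeff_C_mul_X_pow_mul_X_pow_add_C_pow a (c ^ r) s m hr1 hi] at h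
    exact h
  have hne : ∀ i, i < p → (((s + r * i + r).choose r : ℕ) : k) * P.coeff (s + r * i + r) ≠ 0 := by
    intro i hi
    have him : i ≤ m := by omega
    rw [hcoeff i him]
    exact mul_ne_zero (mul_ne_zero ha (natCast_choose_prime_pow_sub_one_ne_zero p hb hi)) (pow_ne_zero _ (pow_ne_zero _ hc))
  -- `r ∣ s`: the exponent `s + r` lies in the support of `P`
  have hrs : r ∣ s := by
    have h0 := hne 0 hp'.pos
    rw [mul_zero, add_zero] at h0
    have hsupp : s + r ∈ P.support := mem_support_iff.mpr (right_ne_zero_of_mul h0)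
    have := hP _ hsupp
    exact (Nat.dvd_add_right (dvd_refl r)).mp (by rwa [add_comm] at this)
  obtain ⟨s', hs'⟩ := hrs
  -- choose `i < p` with `p ∣ s' + i + 1`
  set i := p - 1 - s' % p with hi
  have hip : i < p := by have := Nat.mod_lt s' hp'.pos; omega
  have hdiv : p ∣ s' + i + 1 := by
    have h1 := Nat.mod_add_div s' p
    have h2 := Nat.mod_lt s' hp'.pos
    refine ⟨s' / p + 1, ?_⟩
    rw [hi, Nat.mul_add, mul_one]
    omega
  apply hne i hip
  -- `C(s + r i + r, r) = C(r (s' + i + 1), r) ≡ s' + i + 1 ≡ 0`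
  have hexp : s + r * i + r = r * (s' + i + 1) := by rw [hs']; ring
  rw [hexp, hr, natCast_choose_prime_pow_mul p e (s' + i + 1), (CharP.cast_eq_zero_iff k p _).mpr hdiv, zero_mul]

end CharP

end WildMonic

end Summit.ResolutionOfSingularities.ResolutionOfSingularities.Theorems
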